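import Summits.QuantumFields.YangMills.Theorems.FlatTubeReductionPinnedUnitStepExSplitDoor
import Summits.QuantumFields.YangMills.Theorems.FlatTubeReductionPinnedUnitStepExSplitDefs
import HarnessLib

/-!
# Route `FlatTubeReduction`, crux `PinnedUnitStepEx` (stmt-QuantumFields-27561) — (P1) = N34 ∧ a lam-uniform MOMENTUM FLOOR

Seat leafhand-qf-flattubereduction-1 g0 (2026-08-30).  The existence half (P1) of the open stub `stub_pinnedAutocorrExTI1` («the first zero-flux
excitation of the coarse transfer operator has a zero-momentum member along the femto window»; spectral-bound form `NonZeroMomentumGapTI1`,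
`Theorems/FlatTubeReductionPinnedUnitStepExSplitDefs.lean`) is here reduced to two statements of DIFFERENT provenance:

* the EXISTING ladder leaf `FemtoTransferGap.FemtoLevelsOfRecord` (node N34, `Theorems/FemtoTransferGapLevels.lean`; `@[conjecture]`, fed by
  `Theses.LuscherReduction.RunningReduction` through `femtoLevels_of_reduction`), used only through its `k = 1` LOWER half
  `λ₁′ ≥ e^{−(ε₁λ + Cλ²)/L′}·λ₀′` (the first excitation is CHEAP: energy `O(λ)/L′`);
* the route-posited `NonZeroMomentumFloorTI1` (same Defs file, p794846; taken here as the INLINE hypothesis `hFloor`, verbatim its body, so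
  `h : NonZeroMomentumFloorTI1` is accepted by definitional unfolding): a `lam`-UNIFORM floor `κ/L′` under the energy of every non-zero-momentum
  (zero-translation-average) zero-flux state `⊥ Ω′` (non-zero momenta are EXPENSIVE: the momentum quantum is `2π/L′`).

`nonZeroMomentumGapTI1_of_levels_of_floor : FemtoLevelsOfRecord → NonZeroMomentumFloorTI1 → NonZeroMomentumGapTI1` (take `lam` so small that
`ε₁λ + Cλ² < κ` on the window `λ ≤ 2·lam`; then `θ := e^{−κ/L′}λ₀′ < λ₁′`), and the resulting door
`pinnedAutocorrExTI1_of_levels_of_floor_of_oneStep : FemtoLevelsOfRecord → NonZeroMomentumFloorTI1 → OneStepPinnedComparisonTI1 → PinnedAutocorrExTI1`.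
HONEST FRAMING: doors only; N34, the floor and the one-step comparison (P2, XL) are all OPEN; R2b1 is a RECORD rung; no stub, crux or summit is
proved by this file.
References: M. Lüscher, Nucl. Phys. B219 (1983) §3; M. Lüscher, G. Münster, Nucl. Phys. B232 (1984); P. van Baal, hep-ph/0008206 p. 9.
-/

set_option autoImplicit false

noncomputable section

namespace Summit.QuantumFields.YangMills.Cruxes.PinnedUnitStepEx.TISplit1

open MeasureTheory
open Literature.MathematicalPhysics.QuantumFieldTheory (Site Edge GaugeConfig gaugeTransform)
open Summit.QuantumFields.YangMills.Theorems.FemtoTransferGap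
open Summit.QuantumFields.YangMills.Theorems.FlatTubeReduction
open Literature.Analysis.OperatorTheory.YMMatrixModel (luscherEps1)

/-- Window arithmetic: if `0 ≤ λ ≤ 2·lam`, `lam ≤ min 1 (κ/A)` with `A = 2|ε| + 4|C| + 1`, then `ελ + Cλ² < κ`. [folklore] -/
theorem window_budget_lt {ε C κ lam x : ℝ} (hκ : 0 < κ) (hx0 : 0 ≤ x) (hx : x ≤ 2 * lam)
    (hlam : lam ≤ min 1 (κ / (2 * |ε| + 4 * |C| + 1))) : ε * x + C * x ^ 2 < κ := by
  set A : ℝ := 2 * |ε| + 4 * |C| + 1 with hA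
  have hA0 : 0 < A := by positivity
  have hlam1 : lam ≤ 1 := hlam.trans (min_le_left _ _)
  have hlamκ : lam ≤ κ / A := hlam.trans (min_le_right _ _)
  have hlam0 : 0 ≤ lam := by linarith
  have hx2 : x ≤ 2 := by linarith
  -- `ελ + Cλ² ≤ |ε|λ + |C|λ² ≤ 2|ε| lam + 4|C| lam² ≤ (A − 1) lam`
  have h1 : ε * x ≤ |ε| * (2 * lam) :=
    (le_abs_self _).trans (by rw [abs_mul, abs_of_nonneg hx0]; exact mul_le_mul_of_nonneg_left hx (abs_nonneg _))
  have h2 : C * x ^ 2 ≤ |C| * (4 * lam) := by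
    have hx2' : x ^ 2 ≤ 2 * lam * 2 := by nlinarith
    calc C * x ^ 2 ≤ |C| * x ^ 2 := mul_le_mul_of_nonneg_right (le_abs_self _) (sq_nonneg _)
      _ ≤ |C| * (2 * lam * 2) := mul_le_mul_of_nonneg_left hx2' (abs_nonneg _)
      _ = |C| * (4 * lam) := by ring
  have h3 : ε * x + C * x ^ 2 ≤ (A - 1) * lam := by rw [hA]; linarith
  have hA1 : 0 ≤ A - 1 := by have := abs_nonneg ε; have := abs_nonneg C; rw [hA]; linarith
  have h4 : (A - 1) * lam ≤ (A - 1) * (κ / A) := mul_le_mul_of_nonneg_left hlamκ hA1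
  have h5 : (A - 1) * (κ / A) < κ := by
    rw [sub_mul, one_mul, mul_div_cancel₀ _ hA0.ne']
    have : 0 < κ / A := div_pos hκ hA0
    linarith
  linarith

/-- ★ **(P1) from N34 and the momentum floor.**  The two-sided femto levels law `FemtoLevelsOfRecord` (its `k = 1` lower half
`λ₁′ ≥ e^{−(ε₁λ + Cλ²)/L′}λ₀′`) and the `lam`-uniform non-zero-momentum floor `NonZeroMomentumFloorTI1` (`⟨ψ,K′ψ⟩ ≤ e^{−κ/L′}λ₀′‖ψ‖²` on
zero-average states `⊥ Ω′`) give the spectral-bound form `NonZeroMomentumGapTI1` of (P1), with `θ = e^{−κ/L′}λ₀′` and `lam` so small that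
`ε₁λ + Cλ² < κ` along the window. [cite: Luscher1983, §3] [cite: LuscherMunster1984] -/
theorem nonZeroMomentumGapTI1_of_levels_of_floor (hLev : FemtoLevelsOfRecord)
    (hFloor : ∃ κ : ℝ, 0 < κ ∧ ∃ lam1 : ℝ, 0 < lam1 ∧ ∀ lam : ℝ, 0 < lam → lam ≤ lam1 → ∃ L1 : ℕ, ∀ (L' : ℕ) [NeZero L'], L1 ≤ L' → ∀ β' : ℝ,
          InFemtoWindow lam β' L' →
          ∀ Ω' : Literature.MathematicalPhysics.QuantumFieldTheory.GaugeConfig 3 L' SU2 → ℝ, IsPhys Ω' → ∀ c' : ℝ, 0 < c' → (∀ U', c' ≤ Ω' U') →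
          l2 Ω' Ω' = 1 →
          (∀ U', ∫ V', transferKernel su2Rep β' U' V' * Ω' V' ∂(configMeasure SU2 L') = topValue su2Rep L' β' * Ω' U') →
          ∀ ψ : Literature.MathematicalPhysics.QuantumFieldTheory.GaugeConfig 3 L' SU2 → ℝ, IsPhys ψ →
            (∀ U' : Literature.MathematicalPhysics.QuantumFieldTheory.GaugeConfig 3 L' SU2,
              (Fintype.card (Literature.MathematicalPhysics.QuantumFieldTheory.Site 3 L') : ℝ)⁻¹ *
                ∑ v' : Literature.MathematicalPhysics.QuantumFieldTheory.Site 3 L', ψ (fun e => U' (e.1 - v', e.2)) = 0) →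
            l2 ψ Ω' = 0 → qform su2Rep β' ψ ψ ≤ Real.exp (-κ / (L' : ℝ)) * topValue su2Rep L' β' * l2 ψ ψ) :
    NonZeroMomentumGapTI1 := by
  obtain ⟨C, lam0, hlam0, HL⟩ := hLev 1
  obtain ⟨κ, hκ, lam1, hlam1, HF⟩ := hFloor
  set lamB : ℝ := min 1 (κ / (2 * |luscherEps1| + 4 * |C| + 1)) with hlamB
  have hlamB0 : 0 < lamB := lt_min one_pos (div_pos hκ (by positivity))
  refine ⟨min lam0 (min lam1 lamB), lt_min hlam0 (lt_min hlam1 hlamB0), fun lam hl hle => ?_⟩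
  have hle0 : lam ≤ lam0 := hle.trans (min_le_left _ _)
  have hle1 : lam ≤ lam1 := (hle.trans (min_le_right _ _)).trans (min_le_left _ _)
  have hleB : lam ≤ lamB := (hle.trans (min_le_right _ _)).trans (min_le_right _ _)
  obtain ⟨L0, HL'⟩ := HL lam hl hle0
  obtain ⟨L1, HF'⟩ := HF lam hl hle1
  refine ⟨max L0 L1, ?_⟩
  intro L' _ hL β' hw' Ω' hΩ' c' hc' hlow hn' hE'
  refine ⟨Real.exp (-κ / (L' : ℝ)) * topValue su2Rep L' β', ?_, fun ψ hψ havg horth => ?_⟩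
  · -- `e^{−κ/L′} λ₀′ < e^{−(ε₁λ + Cλ²)/L′} λ₀′ ≤ λ₁′`
    have hlow1 := (HL' L' (le_of_max_le_left hL) β' hw').2
    rw [levelValue_one, levelValue_zero, levelGap_one] at hlow1
    have hL'pos : (0 : ℝ) < (L' : ℝ) := by exact_mod_cast Nat.pos_of_ne_zero (NeZero.ne L')
    have hx0 : 0 ≤ luscherLambda β' L' := hl.le.trans hw'.2.1
    have hbud : luscherEps1 * luscherLambda β' L' + C * luscherLambda β' L' ^ 2 < κ :=
      window_budget_lt hκ hx0 hw'.2.2 (by rw [hlamB] at hleB; exact hleB)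
    have hexp : Real.exp (-κ / (L' : ℝ)) <
        Real.exp (-(luscherEps1 * luscherLambda β' L' + C * luscherLambda β' L' ^ 2) / (L' : ℝ)) := by
      apply Real.exp_lt_exp.2
      rw [neg_div, neg_div, neg_lt_neg_iff]
      exact div_lt_div_of_pos_right hbud hL'pos
    calc Real.exp (-κ / (L' : ℝ)) * topValue su2Rep L' β'
        < Real.exp (-(luscherEps1 * luscherLambda β' L' + C * luscherLambda β' L' ^ 2) / (L' : ℝ)) * topValue su2Rep L' β' :=
          mul_lt_mul_of_pos_right hexp (topValue_su2Rep_pos L' β')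
      _ ≤ secondValue su2Rep L' β' := hlow1
  · exact HF' L' (le_of_max_le_right hL) β' hw' Ω' hΩ' c' hc' hlow hn' hE' ψ hψ havg horth

/-- ★★ **Door: N34 ∧ momentum floor ∧ one-step comparison ⇒ stub 2.**  `FemtoLevelsOfRecord → NonZeroMomentumFloorTI1 →
OneStepPinnedComparisonTI1 → PinnedAutocorrExTI1` (through `nonZeroMomentumGapTI1_of_levels_of_floor` and
`pinnedAutocorrExTI1_of_zeroAvgBound_of_oneStep`).  Door only. [cite: Luscher1983, §3] -/
theorem pinnedAutocorrExTI1_of_levels_of_floor_of_oneStep (hLev : FemtoLevelsOfRecord)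
    (hFloor : ∃ κ : ℝ, 0 < κ ∧ ∃ lam1 : ℝ, 0 < lam1 ∧ ∀ lam : ℝ, 0 < lam → lam ≤ lam1 → ∃ L1 : ℕ, ∀ (L' : ℕ) [NeZero L'], L1 ≤ L' → ∀ β' : ℝ,
          InFemtoWindow lam β' L' →
          ∀ Ω' : Literature.MathematicalPhysics.QuantumFieldTheory.GaugeConfig 3 L' SU2 → ℝ, IsPhys Ω' → ∀ c' : ℝ, 0 < c' → (∀ U', c' ≤ Ω' U') →
          l2 Ω' Ω' = 1 →
          (∀ U', ∫ V', transferKernel su2Rep β' U' V' * Ω' V' ∂(configMeasure SU2 L') = topValue su2Rep L' β' * Ω' U') →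
          ∀ ψ : Literature.MathematicalPhysics.QuantumFieldTheory.GaugeConfig 3 L' SU2 → ℝ, IsPhys ψ →
            (∀ U' : Literature.MathematicalPhysics.QuantumFieldTheory.GaugeConfig 3 L' SU2,
              (Fintype.card (Literature.MathematicalPhysics.QuantumFieldTheory.Site 3 L') : ℝ)⁻¹ *
                ∑ v' : Literature.MathematicalPhysics.QuantumFieldTheory.Site 3 L', ψ (fun e => U' (e.1 - v', e.2)) = 0) →
            l2 ψ Ω' = 0 → qform su2Rep β' ψ ψ ≤ Real.exp (-κ / (L' : ℝ)) * topValue su2Rep L' β' * l2 ψ ψ)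
    (hP2 : OneStepPinnedComparisonTI1) : PinnedAutocorrExTI1 :=
  pinnedAutocorrExTI1_of_zeroAvgBound_of_oneStep (nonZeroMomentumGapTI1_of_levels_of_floor hLev hFloor) hP2

end Summit.QuantumFields.YangMills.Cruxes.PinnedUnitStepEx.TISplit1

end

/-! ## §2 (appended) (P1) from the REVERSE femto law alone (the `k = 1` lower half of N34) and the momentum floor -/

noncomputable section

namespace Summit.QuantumFields.YangMills.Cruxes.PinnedUnitStepEx.TISplit1

open MeasureTheory
open Literature.MathematicalPhysics.QuantumFieldTheory (Site Edge GaugeConfig gaugeTransform)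
open Summit.QuantumFields.YangMills.Theorems.FemtoTransferGap
open Summit.QuantumFields.YangMills.Theorems.FlatTubeReduction
open Literature.Analysis.OperatorTheory.YMMatrixModel (luscherEps1)

/-- ★ **(P1) from the reverse femto law and the momentum floor.**  Only the ONE-SIDED reverse law «the first zero-flux excitation is CHEAP»,
`e^{−(ε₁λ + Cλ²)/L′}·λ₀′ ≤ λ₁′` along the window (hypothesis `hUp`, inline: the `k = 1` lower half of `FemtoLevelsOfRecord`, the mirror image of
the leaf `FemtoGapOfRecord`; a VARIATIONAL statement — lower bounds on `λ₁′` come from two-dimensional trial spaces), together with the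
`lam`-uniform non-zero-momentum floor (`hFloor`, inline body of `NonZeroMomentumFloorTI1`), gives `NonZeroMomentumGapTI1`.
[cite: Luscher1983, §3] [cite: LuscherMunster1984] -/
theorem nonZeroMomentumGapTI1_of_gapUpper_of_floor
    (hUp : ∃ C lam0 : ℝ, 0 < lam0 ∧ ∀ lam : ℝ, 0 < lam → lam ≤ lam0 → ∃ L0 : ℕ, ∀ (L : ℕ) [NeZero L], L0 ≤ L → ∀ β : ℝ,
      InFemtoWindow lam β L →
      Real.exp (-(luscherEps1 * luscherLambda β L + C * luscherLambda β L ^ 2) / L) * topValue su2Rep L β ≤ secondValue su2Rep L β)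
    (hFloor : ∃ κ : ℝ, 0 < κ ∧ ∃ lam1 : ℝ, 0 < lam1 ∧ ∀ lam : ℝ, 0 < lam → lam ≤ lam1 → ∃ L1 : ℕ, ∀ (L' : ℕ) [NeZero L'], L1 ≤ L' → ∀ β' : ℝ,
          InFemtoWindow lam β' L' →
          ∀ Ω' : Literature.MathematicalPhysics.QuantumFieldTheory.GaugeConfig 3 L' SU2 → ℝ, IsPhys Ω' → ∀ c' : ℝ, 0 < c' → (∀ U', c' ≤ Ω' U') →
          l2 Ω' Ω' = 1 →
          (∀ U', ∫ V', transferKernel su2Rep β' U' V' * Ω' V' ∂(configMeasure SU2 L') = topValue su2Rep L' β' * Ω' U') →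
          ∀ ψ : Literature.MathematicalPhysics.QuantumFieldTheory.GaugeConfig 3 L' SU2 → ℝ, IsPhys ψ →
            (∀ U' : Literature.MathematicalPhysics.QuantumFieldTheory.GaugeConfig 3 L' SU2,
              (Fintype.card (Literature.MathematicalPhysics.QuantumFieldTheory.Site 3 L') : ℝ)⁻¹ *
                ∑ v' : Literature.MathematicalPhysics.QuantumFieldTheory.Site 3 L', ψ (fun e => U' (e.1 - v', e.2)) = 0) →
            l2 ψ Ω' = 0 → qform su2Rep β' ψ ψ ≤ Real.exp (-κ / (L' : ℝ)) * topValue su2Rep L' β' * l2 ψ ψ) :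
    NonZeroMomentumGapTI1 := by
  obtain ⟨C, lam0, hlam0, HL⟩ := hUp
  obtain ⟨κ, hκ, lam1, hlam1, HF⟩ := hFloor
  set lamB : ℝ := min 1 (κ / (2 * |luscherEps1| + 4 * |C| + 1)) with hlamB
  have hlamB0 : 0 < lamB := lt_min one_pos (div_pos hκ (by positivity))
  refine ⟨min lam0 (min lam1 lamB), lt_min hlam0 (lt_min hlam1 hlamB0), fun lam hl hle => ?_⟩
  have hle0 : lam ≤ lam0 := hle.trans (min_le_left _ _)
  have hle1 : lam ≤ lam1 := (hle.trans (min_le_right _ _)).trans (min_le_left _ _)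
  have hleB : lam ≤ lamB := (hle.trans (min_le_right _ _)).trans (min_le_right _ _)
  obtain ⟨L0, HL'⟩ := HL lam hl hle0
  obtain ⟨L1, HF'⟩ := HF lam hl hle1
  refine ⟨max L0 L1, ?_⟩
  intro L' _ hL β' hw' Ω' hΩ' c' hc' hlow hn' hE'
  refine ⟨Real.exp (-κ / (L' : ℝ)) * topValue su2Rep L' β', ?_, fun ψ hψ havg horth => ?_⟩
  · have hlow1 := HL' L' (le_of_max_le_left hL) β' hw'
    have hL'pos : (0 : ℝ) < (L' : ℝ) := by exact_mod_cast Nat.pos_of_ne_zero (NeZero.ne L')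
    have hx0 : 0 ≤ luscherLambda β' L' := hl.le.trans hw'.2.1
    have hbud : luscherEps1 * luscherLambda β' L' + C * luscherLambda β' L' ^ 2 < κ :=
      window_budget_lt hκ hx0 hw'.2.2 (by rw [hlamB] at hleB; exact hleB)
    have hexp : Real.exp (-κ / (L' : ℝ)) <
        Real.exp (-(luscherEps1 * luscherLambda β' L' + C * luscherLambda β' L' ^ 2) / (L' : ℝ)) := by
      apply Real.exp_lt_exp.2
      rw [neg_div, neg_div, neg_lt_neg_iff]
      exact div_lt_div_of_pos_right hbud hL'pos
    calc Real.exp (-κ / (L' : ℝ)) * topValue su2Rep L' β'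
        < Real.exp (-(luscherEps1 * luscherLambda β' L' + C * luscherLambda β' L' ^ 2) / (L' : ℝ)) * topValue su2Rep L' β' :=
          mul_lt_mul_of_pos_right hexp (topValue_su2Rep_pos L' β')
      _ ≤ secondValue su2Rep L' β' := hlow1
  · exact HF' L' (le_of_max_le_right hL) β' hw' Ω' hΩ' c' hc' hlow hn' hE' ψ hψ havg horth

/-- The `k = 1` lower half of N34 `FemtoLevelsOfRecord` IS the reverse femto law `hUp` (read through `levelValue_one`, `levelValue_zero`,
`levelGap_one`). [cite: Luscher1983, §3] -/
theorem femtoGapUpper_of_levels (hLev : FemtoLevelsOfRecord) :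
    ∃ C lam0 : ℝ, 0 < lam0 ∧ ∀ lam : ℝ, 0 < lam → lam ≤ lam0 → ∃ L0 : ℕ, ∀ (L : ℕ) [NeZero L], L0 ≤ L → ∀ β : ℝ,
      InFemtoWindow lam β L →
      Real.exp (-(luscherEps1 * luscherLambda β L + C * luscherLambda β L ^ 2) / L) * topValue su2Rep L β ≤ secondValue su2Rep L β := by
  obtain ⟨C, lam0, hlam0, H⟩ := hLev 1
  refine ⟨C, lam0, hlam0, fun lam hl hle => ?_⟩
  obtain ⟨L0, HL⟩ := H lam hl hle
  refine ⟨L0, ?_⟩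
  intro L _ hL β hw
  have h2 := (HL L hL β hw).2
  rw [levelValue_one, levelValue_zero, levelGap_one] at h2
  exact h2

end Summit.QuantumFields.YangMills.Cruxes.PinnedUnitStepEx.TISplit1

end

/-! ## §3 (appended) Zero-average states are orthogonal to the translation-invariant sector (namespace `ZeroMomentum`) -/

noncomputable section

namespace Summit.QuantumFields.YangMills.Theorems.FlatTubeReduction.ZeroMomentum

open MeasureTheory
open Literature.MathematicalPhysics.QuantumFieldTheory (Site Edge GaugeConfig gaugeTransform torusConfigShift torusConfigShift_apply)
open Summit.QuantumFields.YangMills.Theorems.FemtoTransferGap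
open Summit.QuantumFields.YangMills.Theorems.FlatTubeReduction.PinnedSpan

variable {L : ℕ} [NeZero L]

/-- **Zero average ⇒ orthogonal to every translation-invariant physical function** (in particular to the ground state `Ω′`): the
hypothesis `l2 ψ Ω′ = 0` in `NonZeroMomentumGapTI1` / `NonZeroMomentumFloorTI1` is automatic for zero-average `ψ`. [folklore] -/
theorem l2_eq_zero_of_avg_eq_zero {ψ G : GaugeConfig 3 L SU2 → ℝ} (hψ : IsPhys ψ) (hG : IsPhys G)
    (hGTI : ∀ (v : Site 3 L) (U : GaugeConfig 3 L SU2), G (torusConfigShift v U) = G U)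
    (havg : ∀ U, (Fintype.card (Site 3 L) : ℝ)⁻¹ * ∑ v : Site 3 L, ψ (torusConfigShift v U) = 0) : l2 ψ G = 0 := by
  rw [← l2_avg_left_of_ti hψ hG hGTI]
  have h0 : (fun U : GaugeConfig 3 L SU2 => (Fintype.card (Site 3 L) : ℝ)⁻¹ * ∑ v : Site 3 L, ψ (torusConfigShift v U)) =
      fun _ => 0 := funext havg
  rw [h0]
  simp [l2]

/-- The same with the stub's inline spelling of the shift `U ↦ (e ↦ U (e.1 − v, e.2))`. [folklore] -/
theorem l2_eq_zero_of_avg_eq_zero_inline {ψ G : GaugeConfig 3 L SU2 → ℝ} (hψ : IsPhys ψ) (hG : IsPhys G)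
    (hGTI : ∀ (v : Site 3 L) (U : GaugeConfig 3 L SU2), G (fun e => U (e.1 - v, e.2)) = G U)
    (havg : ∀ U : GaugeConfig 3 L SU2, (Fintype.card (Site 3 L) : ℝ)⁻¹ * ∑ v : Site 3 L, ψ (fun e => U (e.1 - v, e.2)) = 0) :
    l2 ψ G = 0 := by
  have hshift : ∀ (v : Site 3 L) (U : GaugeConfig 3 L SU2), torusConfigShift v U = fun e => U (e.1 - v, e.2) :=
    fun v U => funext fun e => torusConfigShift_apply v U e
  exact l2_eq_zero_of_avg_eq_zero hψ hG (fun v U => by rw [hshift]; exact hGTI v U)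
    (fun U => by simpa only [hshift] using havg U)

end Summit.QuantumFields.YangMills.Theorems.FlatTubeReduction.ZeroMomentum

end
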